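import Summits.HubbardSuperconductivity.HubbardSuperconductivity.Theorems.AnisotropyChordDoobJohnsonChordPlan
import Summits.HubbardSuperconductivity.HubbardSuperconductivity.Theorems.AnisotropyChordPerronBranchSmooth
import Summits.HubbardSuperconductivity.HubbardSuperconductivity.Theorems.AnisotropyChordVirialMonotone
import Literature.MathematicalPhysics.QuantumLattice.XXZAntiferromagnetGroundStateUnique
import Literature.MathematicalPhysics.QuantumLattice.SectorEigenvalueContinuation

/-!
# Route `AnisotropyChord`, crux `ChordXY` (stmt-HubbardSuperconductivity-8146), line `doob-johnson-chord`,
# PLAN A / H1: the REAL SECTOR BLOCK of `H_M(u)` on the half-filled configurations carries a positive,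
# gapped bottom eigenpair at every anisotropy (support file, lead-8146-chordxy g1)

Vocabulary of `…Theorems.AnisotropyChordDoobJohnsonChordDefs` (`Config`, `Hxxz`, `Otot`, `lam`, `IsGS`,
`ofReal`, `field`).  The `S^z_tot = 0` sector of the even `M × M` torus is the span of the HALF-FILLED
configurations `{σ // Σ_z σ_z = M²/2}`; on that index type `H_M(u) = xxzHamiltonian 1 (torusGraph 2 M) (-1) u`
is a REAL SYMMETRIC matrix `u ↦ ((H_M(u)) s t).re`, AFFINE (hence `C^∞`) in `u`.  This file proves the
hypotheses of the smooth-Perron-branch theorem `PerronBranch.exists_contDiff_pos_bottom_eigenvector` for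
that family:

* bookkeeping: `halfFilled_label`, `mem_sector_iff_weight`, `hxxz_apply_im`, `hxxz_re_affine`,
  `sectorBlock_contDiff`, `sectorBlock_isSymm`, `sum_weight_subtype` (sums over configurations of a
  function vanishing off the sector are sums over the subtype);
* `sector_mulVec_mem` — `H_M(u)` preserves the sector;
* `mulVec_extend_re` / `mulVec_extend_off` — `H_M(u)` applied to the zero-extension of a real vector on
  the half-filled configurations is the zero-extension of the block applied to it;
* `sectorBlock_perronData` — **for every real `u` the block has a unit eigenvector with ALL ENTRIES
  POSITIVE, eigenvalue `E_M(u) = lowestEnergyInSector 1 (H_M(u)) 0`, STRICTLY below the quadratic form on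
  its orthogonal complement** (Perron vector of `xxz_sector_perron_pos`, normalised; the strict gap from
  uniqueness via `EigenvalueContinuation.exists_gap_of_unique`).

Folklore linear algebra; no definition (the block and the zero-extension are written inline); sorry-free.
HONEST: nothing here proves `ChordXY`; superconductivity in the Hubbard model is not advanced.
-/

set_option linter.dupNamespace false

noncomputable section

namespace Summit.HubbardSuperconductivity.HubbardSuperconductivity.Theorems.AnisotropyChord.DoobJohnsonChord

open Matrix Finset
open scoped ContDiff
open Literature.MathematicalPhysics.QuantumLattice Literature.Probability.LatticeModels
open Summit.HubbardSuperconductivity.HubbardSuperconductivity.Theorems.AnisotropyChord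
  (xxz_sector_perron_pos xxzHamiltonian_affine)

variable (M : ℕ) [NeZero M]

/-! ### Bookkeeping: the half-filled sector -/

/-- For even `M` the magnetisation label of the weight-`M²/2` sector of the `M × M` torus is `0`.
[bookkeeping] -/
theorem halfFilled_label (hM : Even M) :
    ((Fintype.card (TorusSite 2 M) * 1 : ℕ) : ℝ) / 2 - ((M ^ 2 / 2 : ℕ) : ℝ) = 0 := by
  obtain ⟨k, rfl⟩ := hM
  have hk : (k + k) ^ 2 / 2 = 2 * k ^ 2 := by
    rw [show (k + k) ^ 2 = 2 * (2 * k ^ 2) by ring, Nat.mul_div_cancel_left _ (by norm_num)]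
  rw [show Fintype.card (TorusSite 2 (k + k)) = (k + k) ^ 2 by simp [Fintype.card_pi, ZMod.card], hk]
  push_cast
  ring

/-- Membership in the `S^z_tot = 0` sector = vanishing off the half-filled configurations (even `M`).
[bookkeeping] -/
theorem mem_sector_iff_weight (hM : Even M) (φ : Config M → ℂ) :
    φ ∈ spinZSector (Λ := TorusSite 2 M) 1 0 ↔ ∀ σ : Config M, (∑ z, (σ z : ℕ)) ≠ M ^ 2 / 2 → φ σ = 0 := by
  have h := LiebMattis.mem_spinZSector_weight_iff (Λ := TorusSite 2 M) 1 (M ^ 2 / 2) φ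
  rw [halfFilled_label M hM] at h
  exact h

/-- The half-filled configurations form a nonempty type. [bookkeeping] -/
theorem halfFilled_nonempty : Nonempty {σ : Config M // (∑ z, (σ z : ℕ)) = M ^ 2 / 2} := by
  obtain ⟨σ, hσ⟩ := exists_config_weight M (M ^ 2 / 2) (Nat.div_le_self _ _)
  exact ⟨⟨σ, hσ⟩⟩

/-- A sum over all configurations of a function vanishing off the half-filled ones is the sum over the
half-filled subtype. [bookkeeping] -/
theorem sum_weight_subtype {α : Type*} [AddCommMonoid α] (g : Config M → α)
    (hg : ∀ σ : Config M, (∑ z, (σ z : ℕ)) ≠ M ^ 2 / 2 → g σ = 0) :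
    ∑ σ, g σ = ∑ t : {σ : Config M // (∑ z, (σ z : ℕ)) = M ^ 2 / 2}, g t.1 := by
  rw [← Finset.sum_subtype (Finset.univ.filter fun σ : Config M => (∑ z, (σ z : ℕ)) = M ^ 2 / 2)
    (fun σ => by simp) g]
  rw [Finset.sum_filter_of_ne]
  intro σ _ hσ
  by_contra h
  exact hσ (hg σ h)

/-! ### The real sector block -/

/-- The entries of `H_M(u)` are real. [folklore] -/
theorem hxxz_apply_im (u : ℝ) (σ τ : Config M) : (Hxxz M u σ τ).im = 0 :=
  Complex.conj_eq_iff_im.1 (LiebMattis.star_xxzHamiltonian_apply 1 (torusGraph 2 M) (-1) u σ τ)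

/-- The entries of `H_M(u)` as real numbers cast back. [folklore] -/
theorem hxxz_apply_eq_re (u : ℝ) (σ τ : Config M) : Hxxz M u σ τ = (((Hxxz M u σ τ).re : ℝ) : ℂ) :=
  Complex.ext (by simp) (by simp [hxxz_apply_im])

/-- The entries of `H_M(u)` are affine in `u`. [folklore] -/
theorem hxxz_re_affine (u : ℝ) (σ τ : Config M) :
    (Hxxz M u σ τ).re = (Hxxz M 0 σ τ).re + u * ((Hxxz M 1 σ τ).re - (Hxxz M 0 σ τ).re) := by
  unfold Hxxz
  rw [xxzHamiltonian_affine 1 (torusGraph 2 M) (-1) u]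
  simp only [Matrix.add_apply, Matrix.smul_apply, Matrix.sub_apply, smul_eq_mul, Complex.add_re,
    Complex.re_ofReal_mul, Complex.sub_re]

/-- The entries of the sector block are `C^∞` in `u`. [folklore] -/
theorem sectorBlock_contDiff (σ τ : Config M) : ContDiff ℝ ∞ fun u : ℝ => (Hxxz M u σ τ).re := by
  have h : (fun u : ℝ => (Hxxz M u σ τ).re) =
      fun u => (Hxxz M 0 σ τ).re + u * ((Hxxz M 1 σ τ).re - (Hxxz M 0 σ τ).re) :=
    funext fun u => hxxz_re_affine M u σ τ
  rw [h]
  exact contDiff_const.add (contDiff_id.mul contDiff_const)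

/-- The sector block is a symmetric real matrix. [folklore] -/
theorem sectorBlock_isSymm (u : ℝ) :
    (Matrix.of fun s t : {σ : Config M // (∑ z, (σ z : ℕ)) = M ^ 2 / 2} => (Hxxz M u s.1 t.1).re).IsSymm := by
  ext s t
  simp only [transpose_apply, of_apply]
  unfold Hxxz
  rw [LiebMattis.xxzHamiltonian_apply_comm]

/-- `H_M(u)` preserves the sector. [folklore] -/
theorem sector_mulVec_mem (hM : Even M) (u : ℝ) (φ : Config M → ℂ)
    (hφ : φ ∈ spinZSector (Λ := TorusSite 2 M) 1 0) :
    Hxxz M u *ᵥ φ ∈ spinZSector (Λ := TorusSite 2 M) 1 0 := by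
  rw [mem_sector_iff_weight M hM] at hφ ⊢
  intro σ hσ
  rw [mulVec, dotProduct]
  refine Finset.sum_eq_zero fun τ _ => ?_
  by_cases hτ : (∑ z, (τ z : ℕ)) = M ^ 2 / 2
  · have hne : (∑ z, (σ z : ℕ)) ≠ ∑ z, (τ z : ℕ) := by rw [hτ]; exact hσ
    unfold Hxxz
    rw [LiebMattis.xxzHamiltonian_apply_eq_zero_of_weight_ne 1 (torusGraph 2 M) (-1) u hne, zero_mul]
  · rw [hφ τ hτ, mul_zero]

/-! ### Zero-extension of real vectors on the half-filled configurations -/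

/-- The zero-extension of a real vector on the half-filled configurations lies in the sector. [bookkeeping] -/
theorem extend_mem_sector (hM : Even M) (v : {σ : Config M // (∑ z, (σ z : ℕ)) = M ^ 2 / 2} → ℝ) :
    ofReal M (fun σ => if h : (∑ z, (σ z : ℕ)) = M ^ 2 / 2 then v ⟨σ, h⟩ else 0) ∈
      spinZSector (Λ := TorusSite 2 M) 1 0 := by
  rw [mem_sector_iff_weight M hM]
  intro σ hσ
  simp [ofReal, dif_neg hσ]

/-- `H_M(u)` on the zero-extension, at a half-filled configuration: the block applied to the vector.
[bookkeeping] -/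
theorem mulVec_extend_re (u : ℝ) (v : {σ : Config M // (∑ z, (σ z : ℕ)) = M ^ 2 / 2} → ℝ)
    (s : {σ : Config M // (∑ z, (σ z : ℕ)) = M ^ 2 / 2}) :
    (Hxxz M u *ᵥ ofReal M (fun σ => if h : (∑ z, (σ z : ℕ)) = M ^ 2 / 2 then v ⟨σ, h⟩ else 0)) s.1 =
      ((((Matrix.of fun s t : {σ : Config M // (∑ z, (σ z : ℕ)) = M ^ 2 / 2} =>
          (Hxxz M u s.1 t.1).re) *ᵥ v) s : ℝ) : ℂ) := by
  rw [mulVec, dotProduct, mulVec, dotProduct]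
  push_cast
  rw [sum_weight_subtype M (fun τ => Hxxz M u s.1 τ *
      ofReal M (fun σ => if h : (∑ z, (σ z : ℕ)) = M ^ 2 / 2 then v ⟨σ, h⟩ else 0) τ)]
  · refine Finset.sum_congr rfl fun t _ => ?_
    rw [of_apply, hxxz_apply_eq_re M u s.1 t.1]
    simp [ofReal, dif_pos t.2]
  · intro τ hτ
    simp [ofReal, dif_neg hτ]

/-- `H_M(u)` on the zero-extension vanishes off the half-filled configurations. [bookkeeping] -/
theorem mulVec_extend_off (hM : Even M) (u : ℝ) (v : {σ : Config M // (∑ z, (σ z : ℕ)) = M ^ 2 / 2} → ℝ)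
    (σ : Config M) (hσ : (∑ z, (σ z : ℕ)) ≠ M ^ 2 / 2) :
    (Hxxz M u *ᵥ ofReal M (fun σ => if h : (∑ z, (σ z : ℕ)) = M ^ 2 / 2 then v ⟨σ, h⟩ else 0)) σ = 0 :=
  (mem_sector_iff_weight M hM _).1 (sector_mulVec_mem M hM u _ (extend_mem_sector M hM v)) σ hσ

/-- The squared norm of the zero-extension is the real squared norm. [bookkeeping] -/
theorem star_extend_dotProduct_extend (v : {σ : Config M // (∑ z, (σ z : ℕ)) = M ^ 2 / 2} → ℝ) :
    star (ofReal M (fun σ => if h : (∑ z, (σ z : ℕ)) = M ^ 2 / 2 then v ⟨σ, h⟩ else 0)) ⬝ᵥ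
      ofReal M (fun σ => if h : (∑ z, (σ z : ℕ)) = M ^ 2 / 2 then v ⟨σ, h⟩ else 0) = ((v ⬝ᵥ v : ℝ) : ℂ) := by
  rw [dotProduct, dotProduct]
  push_cast
  rw [sum_weight_subtype M]
  · refine Finset.sum_congr rfl fun t _ => ?_
    simp [ofReal, dif_pos t.2, Complex.conj_ofReal]
  · intro τ hτ
    simp [ofReal, dif_neg hτ]

/-- The quadratic form of `H_M(u)` on the zero-extension is the block quadratic form. [bookkeeping] -/
theorem star_extend_dotProduct_mulVec_extend (u : ℝ)
    (v : {σ : Config M // (∑ z, (σ z : ℕ)) = M ^ 2 / 2} → ℝ) :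
    star (ofReal M (fun σ => if h : (∑ z, (σ z : ℕ)) = M ^ 2 / 2 then v ⟨σ, h⟩ else 0)) ⬝ᵥ
      (Hxxz M u *ᵥ ofReal M (fun σ => if h : (∑ z, (σ z : ℕ)) = M ^ 2 / 2 then v ⟨σ, h⟩ else 0)) =
      ((v ⬝ᵥ ((Matrix.of fun s t : {σ : Config M // (∑ z, (σ z : ℕ)) = M ^ 2 / 2} =>
          (Hxxz M u s.1 t.1).re) *ᵥ v) : ℝ) : ℂ) := by
  rw [dotProduct, dotProduct]
  push_cast
  rw [sum_weight_subtype M]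
  · refine Finset.sum_congr rfl fun t _ => ?_
    rw [mulVec_extend_re M u v t]
    simp [ofReal, dif_pos t.2, Complex.conj_ofReal]
  · intro τ hτ
    simp [ofReal, dif_neg hτ]

/-! ### The Perron data of the block -/

/-- A real vector with `v ⬝ᵥ v = 0` vanishes. [folklore] -/
theorem eq_zero_of_dotProduct_self_eq_zero' {ι : Type*} [Fintype ι] (v : ι → ℝ) (h : v ⬝ᵥ v = 0) :
    v = 0 := by
  funext i
  have hle : ∀ j ∈ (Finset.univ : Finset ι), 0 ≤ v j * v j := fun j _ => mul_self_nonneg (v j)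
  have h0 := (Finset.sum_eq_zero_iff_of_nonneg hle).1 h i (Finset.mem_univ i)
  exact mul_self_eq_zero.1 h0

/-- **Perron data of the sector block.**  For even `M` and every real `u`, the real symmetric block of
`H_M(u)` on the half-filled configurations has a unit eigenvector with ALL ENTRIES POSITIVE, with eigenvalue
`E_M(u) = lowestEnergyInSector 1 (H_M(u)) 0`, lying STRICTLY below the quadratic form on the orthogonal
complement (Perron–Frobenius + the gap from uniqueness).  Tasaki (2020) §2.4; Lieb–Wu (2003) §2. [folklore] -/
theorem sectorBlock_perronData (hM : Even M) (u : ℝ) :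
    ∃ n : {σ : Config M // (∑ z, (σ z : ℕ)) = M ^ 2 / 2} → ℝ,
      n ⬝ᵥ n = 1 ∧
      (Matrix.of fun s t : {σ : Config M // (∑ z, (σ z : ℕ)) = M ^ 2 / 2} => (Hxxz M u s.1 t.1).re) *ᵥ n =
        lowestEnergyInSector 1 (Hxxz M u) 0 • n ∧
      (∀ i, 0 < n i) ∧
      ∀ v, v ⬝ᵥ n = 0 → v ≠ 0 →
        lowestEnergyInSector 1 (Hxxz M u) 0 * (v ⬝ᵥ v) <
          v ⬝ᵥ (Matrix.of fun s t : {σ : Config M // (∑ z, (σ z : ℕ)) = M ^ 2 / 2} =>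
            (Hxxz M u s.1 t.1).re) *ᵥ v := by
  haveI := halfFilled_nonempty M
  have hW : ∃ σ : Config M, (∑ z, (σ z : ℕ)) = M ^ 2 / 2 :=
    exists_config_weight M (M ^ 2 / 2) (Nat.div_le_self _ _)
  obtain ⟨ψ₀, hK, hne, hnn, hpos, hoff, hH, huniq⟩ :=
    xxz_sector_perron_pos (torusGraph 2 M) (torusGraph_connected_of_proj 2 M) u (M ^ 2 / 2) hW
  rw [halfFilled_label M hM] at hK hH huniq
  -- the positive real vector on the half-filled configurations
  set n₀ : {σ : Config M // (∑ z, (σ z : ℕ)) = M ^ 2 / 2} → ℝ := fun s => (ψ₀ s.1).re with hn₀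
  have hn₀pos : ∀ s, 0 < n₀ s := fun s => hpos s.1 s.2
  -- the block eigen-equation for `n₀`
  have hTn₀ : (Matrix.of fun s t : {σ : Config M // (∑ z, (σ z : ℕ)) = M ^ 2 / 2} => (Hxxz M u s.1 t.1).re) *ᵥ n₀ = lowestEnergyInSector 1 (Hxxz M u) 0 • n₀ := by
    funext s
    have hrow := congrArg Complex.re (congrFun hH s.1)
    rw [Pi.smul_apply, smul_eq_mul, Complex.re_ofReal_mul] at hrow
    rw [Pi.smul_apply, smul_eq_mul, ← hrow, mulVec, dotProduct, mulVec, dotProduct, Complex.re_sum]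
    rw [sum_weight_subtype M (fun τ => (Hxxz M u s.1 τ * ψ₀ τ).re)]
    · refine Finset.sum_congr rfl fun t _ => ?_
      rw [of_apply, Complex.mul_re, hxxz_apply_im, (hnn t.1).2, mul_zero, sub_zero]
    · intro τ hτ
      rw [hoff τ hτ, mul_zero, Complex.zero_re]
  -- normalisation
  set c : ℝ := n₀ ⬝ᵥ n₀ with hc
  have hcpos : 0 < c := by
    rw [hc, dotProduct]
    exact Finset.sum_pos (fun s _ => mul_pos (hn₀pos s) (hn₀pos s)) Finset.univ_nonempty
  set r : ℝ := Real.sqrt c with hr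
  have hrpos : 0 < r := Real.sqrt_pos.2 hcpos
  have hrr : r * r = c := Real.mul_self_sqrt hcpos.le
  set n : {σ : Config M // (∑ z, (σ z : ℕ)) = M ^ 2 / 2} → ℝ := r⁻¹ • n₀ with hn
  have hn1 : n ⬝ᵥ n = 1 := by
    rw [hn, smul_dotProduct, dotProduct_smul, smul_eq_mul, smul_eq_mul, ← hc, ← hrr]
    field_simp
  have hTn : (Matrix.of fun s t : {σ : Config M // (∑ z, (σ z : ℕ)) = M ^ 2 / 2} => (Hxxz M u s.1 t.1).re) *ᵥ n =
      lowestEnergyInSector 1 (Hxxz M u) 0 • n := by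
    rw [hn, mulVec_smul, hTn₀, smul_comm]
  have hnpos : ∀ i, 0 < n i := fun i => by
    rw [hn, Pi.smul_apply, smul_eq_mul]
    exact mul_pos (inv_pos.2 hrpos) (hn₀pos i)
  refine ⟨n, hn1, hTn, hnpos, ?_⟩
  -- the strict gap on `n^⊥`, from uniqueness of the sector ground state
  have hA : (Hxxz M u)ᴴ = Hxxz M u := (xxzHamiltonian_isHermitian 1 (torusGraph 2 M) (-1) u).eq
  have hKinv : ∀ φ ∈ spinZSector (Λ := TorusSite 2 M) 1 0, Hxxz M u *ᵥ φ ∈ spinZSector (Λ := TorusSite 2 M) 1 0 :=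
    fun φ hφ => sector_mulVec_mem M hM u φ hφ
  have hm : ∀ φ ∈ spinZSector (Λ := TorusSite 2 M) 1 0,
      lowestEnergyInSector 1 (Hxxz M u) 0 * (star φ ⬝ᵥ φ).re ≤ (star φ ⬝ᵥ Hxxz M u *ᵥ φ).re :=
    fun φ hφ =>
    minEnergyOn_mul_le_re_rayleigh (xxzHamiltonian_isHermitian 1 (torusGraph 2 M) (-1) u) _ hφ
  have huniq' : ∀ ψ ∈ spinZSector (Λ := TorusSite 2 M) 1 0,
      Hxxz M u *ᵥ ψ = ((lowestEnergyInSector 1 (Hxxz M u) 0 : ℝ) : ℂ) • ψ → ∃ a : ℂ, ψ = a • ψ₀ :=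
    fun ψ hψ hHψ => huniq ψ hψ hHψ
  obtain ⟨g, hg, hgap⟩ := EigenvalueContinuation.exists_gap_of_unique hA
    (spinZSector (Λ := TorusSite 2 M) 1 0) hKinv hm hne hH huniq'
  intro v hvn hv0
  set w : Config M → ℂ :=
    ofReal M (fun σ => if h : (∑ z, (σ z : ℕ)) = M ^ 2 / 2 then v ⟨σ, h⟩ else 0) with hw
  have hwK : w ∈ spinZSector (Λ := TorusSite 2 M) 1 0 := extend_mem_sector M hM v
  -- `w ⊥ ψ₀`
  have horth : star ψ₀ ⬝ᵥ w = 0 := by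
    have h1 : star ψ₀ ⬝ᵥ w = (((n₀ ⬝ᵥ v : ℝ)) : ℂ) := by
      rw [dotProduct, dotProduct]
      push_cast
      rw [sum_weight_subtype M]
      · refine Finset.sum_congr rfl fun t _ => ?_
        have hψt : ψ₀ t.1 = (((ψ₀ t.1).re : ℝ) : ℂ) := Complex.ext (by simp) (by simp [(hnn t.1).2])
        rw [Pi.star_apply, hψt, Complex.star_def, Complex.conj_ofReal]
        simp [hw, ofReal, dif_pos t.2, hn₀]
      · intro τ hτ
        simp [hw, ofReal, dif_neg hτ]
    have h2 : n₀ ⬝ᵥ v = r * (n ⬝ᵥ v) := by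
      rw [hn, smul_dotProduct, smul_eq_mul, ← mul_assoc, mul_inv_cancel₀ hrpos.ne', one_mul]
    rw [h1, h2, dotProduct_comm n v, hvn, mul_zero, Complex.ofReal_zero]
  have hvv : 0 < v ⬝ᵥ v := by
    rcases (Finset.sum_nonneg fun i (_ : i ∈ Finset.univ) => mul_self_nonneg (v i)).lt_or_eq with h | h
    · exact h
    · exact absurd (eq_zero_of_dotProduct_self_eq_zero' v h.symm) hv0
  have key := hgap w hwK horth
  rw [hw, star_extend_dotProduct_extend M v, star_extend_dotProduct_mulVec_extend M u v,
    Complex.ofReal_re, Complex.ofReal_re] at key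
  have : lowestEnergyInSector 1 (Hxxz M u) 0 * (v ⬝ᵥ v) <
      (lowestEnergyInSector 1 (Hxxz M u) 0 + g) * (v ⬝ᵥ v) := by nlinarith
  exact this.trans_le key

end Summit.HubbardSuperconductivity.HubbardSuperconductivity.Theorems.AnisotropyChord.DoobJohnsonChord

end
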